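import Summits.Ventures.PercRepro.C025ProfileGirthHallSuccB

/-!
# THE HALL FORM OF THE ROW `(q, q+1)` AT GIRTH `≥ q + 1` — PART B′: THE CAPACITY SIDE WITHOUT THE RANK HYPOTHESIS (night-3 g19)

Part B (`cap_of_weights`) used the rank hypothesis `ρ(E) ≥ q + 2` only to know that every rank-`q` set has at least two
points outside its closure (`two_le_card_out`).  Here that consequence is the hypothesis itself:
**`cap_of_weights_out`** — for the same weights `W`, `wgt`, `t` (described by the same hypotheses), if every rank-`q` set `B`
has `m_B = #(E ∖ cl B) ≥ 2`, then `Σ_{B ∈ Rq, B ⊆ S} W(B, S) ≤ 1` for every rank-`(q+1)` set `S`.  The proof is part B's,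
word for word, with the one call replaced.  At `ρ(E) = q + 1` the hypothesis holds exactly when `M` has no coloop
(part E: `two_le_card_out_of_not_one`), which is the case part D did not cover.
No `def`, no `instance`, no notation.  Axioms: standard.
-/

open scoped Matroid

namespace PercRepro

open Set Finset ThmH Staged

namespace GirthRows

variable {α : Type} [DecidableEq α] {M : Matroid α} [M.Finite]

open scoped Classical

/-- **The capacity side of the certificate, from `m_B ≥ 2` for every rank-`q` set.** -/
theorem cap_of_weights_out {q : ℕ} (hg : ∀ T ⊆ M.E, T.encard ≤ q → M.Indep T)
    (hout : ∀ B ∈ Profile.Rq M q, 2 ≤ ((gr M).filter (fun x => x ∉ M.closure (B : Set α))).card)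
    (W : Finset α → Finset α → ℚ) (wgt : Finset α → ℚ) (t : Finset α → ℚ)
    (hw1 : ∀ B : Finset α, B.card = q + 1 →
      wgt B = 1 - 1 / (((gr M).filter (fun x => x ∉ M.closure (B : Set α))).card : ℚ))
    (hw2 : ∀ B : Finset α, B.card = q + 2 → ((gr M).filter (fun x => x ∉ M.closure (B : Set α))).card = 2 →
      2 * q + 1 ≤ ((gr M).filter (fun x => x ∈ M.closure (B : Set α))).card → wgt B = 1 - ((q : ℚ) + 2) * t B)
    (hw3 : ∀ B : Finset α, B.card = q + 2 → ¬ (((gr M).filter (fun x => x ∉ M.closure (B : Set α))).card = 2 ∧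
      2 * q + 1 ≤ ((gr M).filter (fun x => x ∈ M.closure (B : Set α))).card) → wgt B = 1)
    (hw4 : ∀ B : Finset α, wgt B ≤ 1)
    (ht : ∀ B : Finset α, t B = 1 / (2 * ((q : ℚ) + 1) *
      ((((gr M).filter (fun x => x ∈ M.closure (B : Set α))).card - q - 1 : ℕ) : ℚ)))
    (h1 : ∀ B S : Finset α, B ⊆ S → B.card = q → S.card = q + 1 → W B S = 1 / ((q : ℚ) + 1))
    (h2 : ∀ B S : Finset α, B ⊆ S → B.card = q → S.card = q + 2 →
      ((S \ B).filter (fun x => x ∈ M.closure (B : Set α))).card = 1 →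
      W B S = 1 / (((q : ℚ) + 1) * (((gr M).filter (fun x => x ∉ M.closure (B : Set α))).card : ℚ)))
    (h3 : ∀ B S : Finset α, B ⊆ S → q + 1 ≤ B.card → S.card = B.card + 1 →
      ((S \ B).filter (fun x => x ∈ M.closure (B : Set α))).card = 0 → W B S = wgt B)
    (h4 : ∀ B S : Finset α, B ⊆ S → B.card = q + 1 →
      ((gr M).filter (fun x => x ∉ M.closure (B : Set α))).card = 2 →
      2 * q + 1 ≤ ((gr M).filter (fun x => x ∈ M.closure (B : Set α))).card → S.card = q + 3 →
      ((S \ B).filter (fun x => x ∈ M.closure (B : Set α))).card = 1 → W B S = t B)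
    (h0 : ∀ B S : Finset α,
      ¬ (B ⊆ S ∧ B.card = q ∧ S.card = q + 1) →
      ¬ (B ⊆ S ∧ B.card = q ∧ S.card = q + 2 ∧ ((S \ B).filter (fun x => x ∈ M.closure (B : Set α))).card = 1) →
      ¬ (B ⊆ S ∧ q + 1 ≤ B.card ∧ S.card = B.card + 1 ∧
          ((S \ B).filter (fun x => x ∈ M.closure (B : Set α))).card = 0) →
      ¬ (B ⊆ S ∧ B.card = q + 1 ∧ ((gr M).filter (fun x => x ∉ M.closure (B : Set α))).card = 2 ∧
          2 * q + 1 ≤ ((gr M).filter (fun x => x ∈ M.closure (B : Set α))).card ∧ S.card = q + 3 ∧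
          ((S \ B).filter (fun x => x ∈ M.closure (B : Set α))).card = 1) → W B S = 0) :
    ∀ S ∈ Shadow.levelSet M (q + 1), ∑ B ∈ (Profile.Rq M q).filter (fun B => B ⊆ S), W B S ≤ 1 := by
  intro S hS
  rw [Profile.mem_levelSet] at hS
  obtain ⟨hSg, hSr'⟩ := hS
  have hSr : rkN M S = q + 1 := Staged.rkN_eq_iff.2 hSr'
  have hSc1 : q + 1 ≤ S.card := by have := Staged.rkN_le_card (M := M) S; omega
  set L := (Profile.Rq M q).filter (fun B => B ⊆ S) with hL
  have hLmem : ∀ B ∈ L, B ∈ Profile.Rq M q ∧ B ⊆ S := by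
    intro B hB; rw [hL, Finset.mem_filter] at hB; exact hB
  -- the rank of a member is q
  have hrk : ∀ B ∈ L, rkN M B = q := fun B hB => Staged.rkN_eq_iff.2 (Profile.mem_Rq.1 (hLmem B hB).1).2
  rcases Nat.lt_or_ge S.card (q + 2) with hk1 | hk2
  · -- |S| = q + 1: the loaders are the q-subsets, each 1/(q+1)
    have hSc : S.card = q + 1 := by omega
    have hLeq : L = Finset.powersetCard q S := by
      ext B
      rw [hL, Finset.mem_filter, Finset.mem_powersetCard]
      constructor
      · rintro ⟨hB, hBS⟩
        exact ⟨hBS, card_eq_of_mem_Rq_subset_succ hSr hSc hB hBS⟩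
      · rintro ⟨hBS, hBc⟩
        exact ⟨mem_Rq_of_card_eq hg (hBS.trans hSg) hBc, hBS⟩
    rw [hLeq]
    have hval : ∀ B ∈ Finset.powersetCard q S, W B S = 1 / ((q : ℚ) + 1) := by
      intro B hB
      rw [Finset.mem_powersetCard] at hB
      exact h1 B S hB.1 hB.2 hSc
    rw [Finset.sum_congr rfl hval, Finset.sum_const, Finset.card_powersetCard, hSc, Nat.choose_succ_self_right,
      nsmul_eq_mul]
    have hpos : (0 : ℚ) < (q : ℚ) + 1 := by positivity
    rw [mul_one_div]
    have : ((q + 1 : ℕ) : ℚ) = (q : ℚ) + 1 := by push_cast; ring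
    rw [this, div_self hpos.ne']
  · -- |S| ≥ q + 2: the apex
    -- every loader B ∈ L with W B S ≠ 0 is ⊆ S ∖ y for an apex y
    set A := S.filter (fun y => rkN M (S.erase y) = q) with hA
    have hAle : ∀ y ∈ A, ∀ y' ∈ A, y = y' := by
      intro y hy y' hy'
      rw [hA, Finset.mem_filter] at hy hy'
      exact apex_unique hg hSg hSr hk2 hy.1 hy'.1 hy.2 hy'.2
    -- a loader with nonzero weight produces an apex
    have hapex : ∀ B ∈ L, W B S ≠ 0 → ∃ y ∈ A, B ⊆ S.erase y := by
      intro B hB hW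
      obtain ⟨hBq, hBS⟩ := hLmem B hB
      obtain ⟨y, hy, hry, hBy⟩ := subset_erase_apex_of_weight_ne_zero hSg hk2 W h0 hBq hBS hW
      exact ⟨y, by rw [hA, Finset.mem_filter]; exact ⟨hy, hry⟩, hBy⟩
    -- no apex: every weight is 0
    by_cases hAe : A = ∅
    · apply le_of_eq_of_le _ zero_le_one
      apply Finset.sum_eq_zero
      intro B hB
      by_contra hW
      obtain ⟨y, hy, _⟩ := hapex B hB hW
      rw [hAe] at hy
      exact Finset.notMem_empty y hy
    -- an apex y, X = S ∖ y
    obtain ⟨y, hy⟩ := Finset.nonempty_iff_ne_empty.2 hAe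
    have hy' := Finset.mem_filter.1 (show y ∈ S.filter (fun y => rkN M (S.erase y) = q) from hy)
    have hyS : y ∈ S := hy'.1
    have hry : rkN M (S.erase y) = q := hy'.2
    set X := S.erase y with hX
    have hXg : X ⊆ gr M := (Finset.erase_subset y S).trans hSg
    have hXc : X.card = S.card - 1 := Finset.card_erase_of_mem hyS
    have hXq : X ∈ Profile.Rq M q := by rw [Profile.mem_Rq]; exact ⟨hXg, Staged.rkN_eq_iff.1 hry⟩
    have hXL : X ∈ L := by rw [hL, Finset.mem_filter]; exact ⟨hXq, Finset.erase_subset y S⟩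
    have hyX : y ∉ X := Finset.notMem_erase y S
    have hyg : y ∈ gr M := hSg hyS
    have hycl : y ∉ M.closure (X : Set α) := by
      rw [mem_closure_iff_rkN_insert hXg hyg, hX, Finset.insert_erase hyS, hSr, hry]; omega
    have hSX : S = insert y X := by rw [hX, Finset.insert_erase hyS]
    -- every nonzero loader is ⊆ X
    have hsubX : ∀ B ∈ L, W B S ≠ 0 → B ⊆ X := by
      intro B hB hW
      obtain ⟨y', hy', hBy'⟩ := hapex B hB hW
      have : y' = y := hAle y' hy' y hy
      rw [this] at hBy'
      exact hBy'
    -- the closure of a subset of X of rank q is that of X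
    have hclB : ∀ B ⊆ X, rkN M B = q →
        ((gr M).filter (fun x => x ∉ M.closure (B : Set α))).card =
          ((gr M).filter (fun x => x ∉ M.closure (X : Set α))).card ∧
        ((gr M).filter (fun x => x ∈ M.closure (B : Set α))).card =
          ((gr M).filter (fun x => x ∈ M.closure (X : Set α))).card := by
      intro B hBX hBr
      have := filters_eq_of_subset_of_rkN_eq hXg hBX (by rw [hry, hBr])
      exact ⟨by rw [this.2], by rw [this.1]⟩
    -- cnt(B, S) for B ⊆ X of rank q: the points of X ∖ B are in cl B, y is not
    have hcnt : ∀ B ⊆ X, rkN M B = q →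
        ((S \ B).filter (fun x => x ∈ M.closure (B : Set α))).card = X.card - B.card := by
      intro B hBX hBr
      have hBg : B ⊆ gr M := hBX.trans hXg
      have hcl : M.closure (B : Set α) = M.closure (X : Set α) :=
        (closure_eq_of_subset_of_rkN_eq hXg hBX (by rw [hry, hBr])).symm
      have heq : (S \ B).filter (fun x => x ∈ M.closure (B : Set α)) = X \ B := by
        ext z
        rw [Finset.mem_filter, Finset.mem_sdiff, Finset.mem_sdiff, hcl]
        constructor
        · rintro ⟨⟨hzS, hzB⟩, hzc⟩
          refine ⟨?_, hzB⟩
          rw [hX, Finset.mem_erase]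
          refine ⟨?_, hzS⟩
          rintro rfl
          exact hycl hzc
        · rintro ⟨hzX, hzB⟩
          refine ⟨⟨(Finset.erase_subset y S) hzX, hzB⟩, ?_⟩
          have hzE : (z : α) ∈ (X : Set α) := Finset.mem_coe.2 hzX
          have hXE : (X : Set α) ⊆ M.E := by rw [← coe_gr]; exact_mod_cast hXg
          exact M.subset_closure (X : Set α) hXE hzE
      rw [heq, Finset.card_sdiff_of_subset hBX]
    -- the value of W on L
    rcases Nat.lt_or_ge S.card (q + 3) with hk2' | hk3
    · -- |S| = q + 2, |X| = q + 1
      have hSc : S.card = q + 2 := by omega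
      have hXc' : X.card = q + 1 := by omega
      set m := ((gr M).filter (fun x => x ∉ M.closure (X : Set α))).card with hm
      have hm2 : 2 ≤ m := hout X hXq
      have hmq : (0 : ℚ) < m := by exact_mod_cast (by omega : 0 < m)
      have hval : ∀ B ∈ L, W B S = if B = X then 1 - 1 / (m : ℚ)
          else if B ⊆ X then 1 / (((q : ℚ) + 1) * (m : ℚ)) else 0 := by
        intro B hB
        obtain ⟨hBq, hBS⟩ := hLmem B hB
        have hBr := hrk B hB
        by_cases hBX : B = X
        · rw [if_pos hBX, hBX]
          rw [h3 X S (Finset.erase_subset y S) (by omega) (by omega) (by rw [hcnt X (subset_refl X) hry]; omega), hw1 X hXc']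
        · rw [if_neg hBX]
          by_cases hBX' : B ⊆ X
          · rw [if_pos hBX']
            have hBc : B.card = q := by
              have h1' : B.card ≤ X.card := Finset.card_le_card hBX'
              have h2' : rkN M B ≤ B.card := Staged.rkN_le_card B
              rcases Nat.lt_or_ge B.card (q + 1) with hlt | hge
              · omega
              · exfalso; exact hBX (Finset.eq_of_subset_of_card_le hBX' (by omega))
            rw [h2 B S hBS hBc hSc (by rw [hcnt B hBX' hBr]; omega), (hclB B hBX' hBr).1]
          · rw [if_neg hBX']
            by_contra hW
            exact hBX' (hsubX B hB hW)
      rw [Finset.sum_congr rfl hval]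
      rw [Finset.sum_ite, Finset.sum_ite]
      have hfX : L.filter (fun B => B = X) = {X} := by
        ext B; rw [Finset.mem_filter, Finset.mem_singleton]
        constructor
        · rintro ⟨_, h⟩; exact h
        · rintro rfl; exact ⟨hXL, rfl⟩
      have hfq : (L.filter (fun B => ¬ B = X)).filter (fun B => B ⊆ X) = Finset.powersetCard q X := by
        ext B
        rw [Finset.mem_filter, Finset.mem_filter, Finset.mem_powersetCard]
        constructor
        · rintro ⟨⟨hB, hBX⟩, hBX'⟩
          refine ⟨hBX', ?_⟩
          have h1' : B.card ≤ X.card := Finset.card_le_card hBX'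
          have h2' : rkN M B ≤ B.card := Staged.rkN_le_card B
          have hBr := hrk B hB
          rcases Nat.lt_or_ge B.card (q + 1) with hlt | hge
          · omega
          · exfalso; exact hBX (Finset.eq_of_subset_of_card_le hBX' (by omega))
        · rintro ⟨hBX', hBc⟩
          refine ⟨⟨?_, ?_⟩, hBX'⟩
          · rw [hL, Finset.mem_filter]
            exact ⟨mem_Rq_of_card_eq hg (hBX'.trans hXg) hBc, hBX'.trans (Finset.erase_subset y S)⟩
          · intro h; rw [h] at hBc; omega
      rw [hfX, hfq, Finset.sum_singleton, Finset.sum_const, Finset.sum_const_zero, Finset.card_powersetCard, hXc',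
        Nat.choose_succ_self_right, nsmul_eq_mul, add_zero]
      have hpos : (0 : ℚ) < (q : ℚ) + 1 := by positivity
      have : ((q + 1 : ℕ) : ℚ) = (q : ℚ) + 1 := by push_cast; ring
      rw [this]
      field_simp
      linarith
    · rcases Nat.lt_or_ge S.card (q + 4) with hk3' | hk4
      · -- |S| = q + 3, |X| = q + 2
        have hSc : S.card = q + 3 := by omega
        have hXc' : X.card = q + 2 := by omega
        set m := ((gr M).filter (fun x => x ∉ M.closure (X : Set α))).card with hm
        set N := ((gr M).filter (fun x => x ∈ M.closure (X : Set α))).card with hN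
        -- the proper loaders of X with nonzero weight are its (q+1)-subsets, under the condition
        have hfX : L.filter (fun B => B = X) = {X} := by
          ext B; rw [Finset.mem_filter, Finset.mem_singleton]
          constructor
          · rintro ⟨_, h⟩; exact h
          · rintro rfl; exact ⟨hXL, rfl⟩
        have hfq : (L.filter (fun B => ¬ B = X)).filter (fun B => B ⊆ X ∧ B.card = q + 1) =
            Finset.powersetCard (q + 1) X := by
          ext B
          rw [Finset.mem_filter, Finset.mem_filter, Finset.mem_powersetCard]
          constructor
          · rintro ⟨⟨_, _⟩, hBX', hBc⟩; exact ⟨hBX', hBc⟩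
          · rintro ⟨hBX', hBc⟩
            refine ⟨⟨?_, ?_⟩, hBX', hBc⟩
            · rw [hL, Finset.mem_filter]
              exact ⟨mem_Rq_of_subset hg hXg hry hBX' (by omega), hBX'.trans (Finset.erase_subset y S)⟩
            · intro h; rw [h] at hBc; omega
        -- the weight of a proper subset B ⊊ X of rank q
        have hsub : ∀ B ∈ L, B ≠ X → B ⊆ X →
            W B S = if (B.card = q + 1 ∧ m = 2 ∧ 2 * q + 1 ≤ N) then t X else 0 := by
          intro B hB hBX hBX'
          obtain ⟨hBq, hBS⟩ := hLmem B hB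
          have hBr := hrk B hB
          have hf := hclB B hBX' hBr
          have hBcle : B.card ≤ q + 1 := by
            have h1' : B.card ≤ X.card := Finset.card_le_card hBX'
            rcases Nat.lt_or_ge B.card (q + 2) with hlt | hge
            · omega
            · exfalso; exact hBX (Finset.eq_of_subset_of_card_le hBX' (by omega))
          by_cases hc : B.card = q + 1 ∧ m = 2 ∧ 2 * q + 1 ≤ N
          · rw [if_pos hc]
            rw [h4 B S hBS hc.1 (by rw [hf.1]; exact hc.2.1) (by rw [hf.2]; exact hc.2.2) hSc
              (by rw [hcnt B hBX' hBr]; omega), ht B, ht X, hf.2]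
          · rw [if_neg hc]
            apply h0 B S
            · rintro ⟨_, _, h⟩; omega
            · rintro ⟨_, _, h, _⟩; omega
            · rintro ⟨_, h, h', _⟩; omega
            · rintro ⟨_, h1', h2', h3', _, _⟩
              apply hc
              refine ⟨h1', ?_, ?_⟩
              · rw [← hf.1]; exact h2'
              · rw [← hf.2]; exact h3'
        have hval : ∀ B ∈ L, W B S = if B = X then wgt X
            else if (B ⊆ X ∧ B.card = q + 1) then (if (m = 2 ∧ 2 * q + 1 ≤ N) then t X else 0) else 0 := by
          intro B hB
          by_cases hBX : B = X
          · rw [if_pos hBX, hBX]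
            exact h3 X S (Finset.erase_subset y S) (by omega) (by omega) (by rw [hcnt X (subset_refl X) hry]; omega)
          · rw [if_neg hBX]
            by_cases hBX' : B ⊆ X
            · rw [hsub B hB hBX hBX']
              by_cases hBc : B.card = q + 1
              · have c1 : B ⊆ X ∧ B.card = q + 1 := ⟨hBX', hBc⟩
                rw [if_pos c1]
                by_cases hc : m = 2 ∧ 2 * q + 1 ≤ N
                · have c2 : B.card = q + 1 ∧ m = 2 ∧ 2 * q + 1 ≤ N := ⟨hBc, hc⟩
                  rw [if_pos c2, if_pos hc]
                · have c2 : ¬ (B.card = q + 1 ∧ m = 2 ∧ 2 * q + 1 ≤ N) := fun h => hc h.2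
                  rw [if_neg c2, if_neg hc]
              · have c1 : ¬ (B ⊆ X ∧ B.card = q + 1) := fun h => hBc h.2
                have c2 : ¬ (B.card = q + 1 ∧ m = 2 ∧ 2 * q + 1 ≤ N) := fun h => hBc h.1
                rw [if_neg c1, if_neg c2]
            · have hz : W B S = 0 := by
                by_contra hW
                exact hBX' (hsubX B hB hW)
              have c1 : ¬ (B ⊆ X ∧ B.card = q + 1) := fun h => hBX' h.1
              rw [hz, if_neg c1]
        rw [Finset.sum_congr rfl hval, Finset.sum_ite, Finset.sum_ite, hfX, hfq, Finset.sum_singleton,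
          Finset.sum_const, Finset.sum_const_zero, Finset.card_powersetCard, hXc', Nat.choose_succ_self_right,
          nsmul_eq_mul, add_zero]
        by_cases hc : m = 2 ∧ 2 * q + 1 ≤ N
        · rw [if_pos hc, hw2 X hXc' hc.1 hc.2]
          have : ((q + 2 : ℕ) : ℚ) = (q : ℚ) + 2 := by push_cast; ring
          rw [this]
          linarith
        · rw [if_neg hc, hw3 X hXc' hc, mul_zero, add_zero]
      · -- |S| ≥ q + 4: only X loads, with weight ≤ 1
        have hval : ∀ B ∈ L, W B S = if B = X then wgt X else 0 := by
          intro B hB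
          obtain ⟨hBq, hBS⟩ := hLmem B hB
          have hBr := hrk B hB
          by_cases hBX : B = X
          · rw [if_pos hBX, hBX]
            exact h3 X S (Finset.erase_subset y S) (by omega) (by omega) (by rw [hcnt X (subset_refl X) hry]; omega)
          · rw [if_neg hBX]
            by_cases hBX' : B ⊆ X
            · have hBlt : B.card < X.card := by
                rcases Nat.lt_or_ge B.card X.card with hlt | hge
                · exact hlt
                · exfalso; exact hBX (Finset.eq_of_subset_of_card_le hBX' hge)
              apply h0 B S
              · rintro ⟨_, _, h⟩; omega
              · rintro ⟨_, _, h, _⟩; omega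
              · rintro ⟨_, _, h, _⟩; omega
              · rintro ⟨_, _, _, _, h, _⟩; omega
            · by_contra hW
              exact hBX' (hsubX B hB hW)
        have hfX : L.filter (fun B => B = X) = {X} := by
          ext B; rw [Finset.mem_filter, Finset.mem_singleton]
          constructor
          · rintro ⟨_, h⟩; exact h
          · rintro rfl; exact ⟨hXL, rfl⟩
        rw [Finset.sum_congr rfl hval, Finset.sum_ite, hfX, Finset.sum_singleton, Finset.sum_const_zero, add_zero]
        exact hw4 X

end GirthRows

end PercRepro
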